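import Mathlib
import HarnessLib
import Summits.Parity.BatemanHorn.Theses.OddParityLadder

/-!
# Route `OddParityLadder`, glue item `OddRoughGlue` (split gen 1 of the deciding crux `OddRough`, item stmt-Parity-30155)

The glue of the decomp-parity node B1.1.1.2 «LiouvilleSignFloor» (lens-1 g5; critic CLEARED HOME/STATUS.md
l.250, CRITIC-LEDGER row 53; filed as `ledger route edit --split OddRough` = route rev 3, commit eeafa223f5f9):
`OddSignQuad → OddSignRest → OddSignLift → OddRough`.  `OddSignLift` (stmt-Parity-30154) is literally `OddRough`
(stmt-Parity-28276) with ONE extra hypothesis per system — the qualitative Liouville-sign floor "infinitely many n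
with all fᵢ(n) > 1 and k + ΣΩ(fᵢ(n)) even" — and that hypothesis is supplied by the degree-profile case split of
the born `closes`: a single quadratic gets it from `OddSignQuad` (stmt-Parity-30152; bookkeeping `Fin 1`,
`Even (1 + a) ↔ Odd a`), every other non-linear system from `OddSignRest` (stmt-Parity-30153).  This is the lens
kernel's `oddRough_of_pieces` (HOME/decomp-parity-lens-1/g5/LiouvilleSignFloor.lean @10647a4cce124d83) written
against the born decls; no mathematics beyond the route file.  Candidate proof by the planner (lens-1 g5); to be
landed verbatim by a hand as `Summits/Parity/BatemanHorn/Theorems/OddParityLadderOddRoughGlue.lean --supports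
stmt-Parity-30155`.
-/

namespace Summit.Parity.BatemanHorn.Theses.OddParityLadder

open Polynomial

/-- `Even (1 + a) ↔ Odd a`. [folklore] -/
theorem oddRoughGlue_even_one_add_iff_odd (a : ℕ) : Even (1 + a) ↔ Odd a := by
  rw [add_comm, Nat.even_add_one, Nat.not_even_iff_odd]

/-- Single-quadratic bookkeeping: for `f = ![q]` the floor set in `OddSignLift`'s hypothesis (k = 1) is the
set in `OddSignQuad`'s conclusion. [folklore] -/
theorem oddRoughGlue_floorSet_single (q : ℤ[X]) :
    {n : ℕ | (∀ i, 1 < ((![q] : Fin 1 → ℤ[X]) i).eval (n : ℤ)) ∧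
        Even (1 + ∑ i, ArithmeticFunction.cardFactors ((((![q] : Fin 1 → ℤ[X]) i).eval (n : ℤ)).toNat))} =
      {n : ℕ | 1 < q.eval (n : ℤ) ∧ Odd (ArithmeticFunction.cardFactors ((q.eval (n : ℤ)).toNat))} := by
  ext n
  simp only [Set.mem_setOf_eq, Fin.forall_fin_one, Matrix.cons_val_zero, Fin.sum_univ_one,
    oddRoughGlue_even_one_add_iff_odd]

/-- **`OddRoughGlue` holds** (item stmt-Parity-30155): `OddSignQuad → OddSignRest → OddSignLift → OddRough` —
feed `OddRough`'s data to `OddSignLift` and discharge its floor hypothesis by the degree-profile case split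
(single quadratic: `OddSignQuad`; otherwise: `OddSignRest`). -/
theorem oddRoughGlue_holds : OddRoughGlue := by
  intro hQ hR hL k f hf hex
  refine hL k f hf hex ?_
  by_cases hc : k = 1 ∧ ∀ i, (f i).natDegree = 2
  · obtain ⟨rfl, hdeg⟩ := hc
    have hvec : f = ![f 0] := by
      ext i
      rw [Fin.fin_one_eq_zero i]
      rfl
    rw [hvec] at hf ⊢
    rw [oddRoughGlue_floorSet_single]
    exact hQ (f 0) hf (hdeg 0)
  · exact hR k f hf hex hc

end Summit.Parity.BatemanHorn.Theses.OddParityLadder
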